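import Summits.QuantumFields.YangMills.Theorems.BalabanUVNodesN15TwoGridDressedUnitLayerN15At
import HarnessLib

/-!
# N15 (NE2) — PROGRAMME Λ-U, part Λ-G: COHERENCE, NON-VACUITY AND THE FAMILY-KEYED (`d + 1 = 4`, block factor `F.L`) EDITIONS OF Λ-F's LITERAL `allEntriesBgObjects`
# (the referee's A2∕A5 exhibits and the faces the keyed homes consume)

WHO ∕ WHEN.  Cell `pub-ymgap`, seat `pub-ymgap-dag-n15-a` (KNIT-BY-NAME seat of Track-A DAG node N15 = NE2, g27); `--kind proof --supports stmt-QuantumFields-27366 --as helper` (K3⁸;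
count-neutral).  THEOREMS ONLY (0 `def`).  Over Λ-F `…TwoGridDressedUnitLayerN15At` (`foCovBg`, `foCovBg_one`, `ne2PlusUnit_foCovBg`, `n15At_allEntries_unitBg`, `live_allEntries_unitBg`,
`allEntriesBgObjects`, `n15At_∕live_allEntriesBgObjects`, `s_N15_of_admits_allEntriesBg`), Λ-C (`ne2PlusOperator_allEntries_fullG`), S-D (`covOnS`, `covOnS_ker`), part 76 (`tgCovStep_ker`), part
82 (`tgIndexS_nonempty`), II-E (`reg335_coeffBgFO_iff`, `foInstanceFG_gf_M`), part 30 (`neZero_blockFactor`), RR-1 (`NE2Objects₁₁.populated_iff`) BY NAME; nothing in the tree is modified.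
PATTERN = U-D §3 ∕ S-B (`populated_…`, `…_family`).

WHAT.  §1 COHERENCE: `foCovBg_one_eq_covOnS` — at the trivial configuration the U-seeing unit kernel IS the socket's U-blind one (Λ-D's `covOnS`): the background-live family EXTENDS the
`U ≡ 1` knit.  §2 NON-VACUITY (A5): `reg335_const_coeffBgFO` (the constant pair `(c₃₅M_szα₀, 0)` is (3.35)-regular), `const_ne_one_coeffBgFO` (and is NOT the trivial configuration when
`c₃₅M_szα₀ ≠ 0`), ★ `exists_reg335_ne_one` (at every sized index and every `α₀ > 0` the (3.35)-class at level `c₃₅ > 0` contains a configuration other than `one`: the layers' `∀ U, Reg335 → …`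
quantify over more than `U ≡ 1`), `populated_allEntriesBgObjects`.  §3 THE FAMILY-KEYED EDITIONS at `(d, L) := (3, F.L)` for a four-torus family `F` (`F.hL : Odd F.L ∧ 1 < F.L` ⇒ `3 ≤ F.L`):
`three_le_blockFactor`, ★★ `n15At_allEntriesBgObjects_family`, ★★ `live_allEntriesBgObjects_family`, `populated_allEntriesBgObjects_family`, ★★ `s_N15_of_admits_allEntriesBg_family`.

HONEST FRAMING ∕ LIMITS.  Bookkeeping BY NAME; no estimate here.  MODEL-LEVEL family (abelianised first-order species of (3.52)'s `V′(A)`, (C3), abelianised `Q`, linearised (1.66) dressing);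
operator (all four (3.42) entries) and unit layers read `U`, site layer U-blind; NOT [B9] Thms 3.1∕3.2∕3.15 at general `U`, NOT Node 00's objects of record, NOT the non-abelian dressing —
N15 NOT discharged; K3⁸ OPEN; counts UNMOVED by this seat; one finite 𝕋⁴ at fixed ε per index — NOT ℝ⁴ ∕ infinite volume ∕ OS ∕ mass gap ∕ Clay.
-/

noncomputable section

namespace Summit.QuantumFields.YangMills.BalabanUVNodes.N15.UnitLayerBg

open Literature.MathematicalPhysics.QuantumFieldTheory.Balaban1983to89
open Literature.MathematicalPhysics.QuantumFieldTheory.Balaban1983to89.T4Continuum (T4Family ULoop)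
open Literature.MathematicalPhysics.QuantumFieldTheory.Balaban1983to89.B5Prop11Plancherel (Tor fine)
open Node00 (NE2Objects₁₁)
open Summit.QuantumFields.YangMills.BalabanUVNodes.N15.TwoGrid (TGIndex coeffBgFO reg335_coeffBgFO_iff foInstanceFG foFamilyAllFG)
open Summit.QuantumFields.YangMills.BalabanUVNodes.N15.VectorPiece (blkFine kingPrV bshiftEquiv)
open Summit.QuantumFields.YangMills.BalabanUVNodes.N15.BackgroundLayer (fgrad fgrad_apply)
open Summit.QuantumFields.YangMills.BalabanUVNodes.N15.GenuineRecord (TGIndexS tgIndexS_nonempty siteOnS covOnS covOnS_ker tgCovStep_ker)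
open Summit.QuantumFields.YangMills.BalabanUVNodes.N15.AtKeyedHome (s_N15_of_admits neZero_blockFactor)
open Summit.QuantumFields.YangMills.BalabanUVNodes.N15.PairedFamilyGuard (Live)
open YMDAG.UVSplit (Datum NE2Carriers RateCarriers RateRecordPred N15At S_N15 ne2OfRecord₁₁)

variable {d : ℕ} {L : ℕ} [NeZero L]

/-! ## §1 Coherence with the `U ≡ 1` knit -/

/-- **THE U-SEEING UNIT KERNEL EXTENDS THE SOCKET's U-BLIND ONE**: at the trivial configuration `foCovBg` reads part 76's (2.156) difference, which is `covOnS`'s value at every configuration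
(`foCovBg_one`, `covOnS_ker`, `tgCovStep_ker`). [cite: Balaban1984PropagatorsII, (2.156) p.250 (object)] -/
theorem foCovBg_one_eq_covOnS (hL : Odd L ∧ 1 < L) (b : ℝ) (α β : Fin (d + 1)) (j : TGIndexS) (U : (foInstanceFG d hL j).Bf.Cfg) (y y' : Tor (TGIndex.Mn d hL j.toTGIndex)) :
    (foCovBg d hL b α β j).ker (foInstanceFG d hL j).Bf.one y y' =
      (covOnS d hL α β TGIndexS.toTGIndex TGIndexS.Msz (fun j => Tor (fine (L ^ j.k) (TGIndex.Mn d hL j.toTGIndex)) × Fin (d + 1))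
        (fun j => blkFine L j.k (TGIndex.Mn d hL j.toTGIndex)) (fun j => (foInstanceFG d hL j).Bf) j).ker U y y' := by
  rw [foCovBg_one, covOnS_ker, tgCovStep_ker]

/-! ## §2 Non-vacuity of the (3.35)-class on the coefficient carrier -/

/-- THE CONSTANT COEFFICIENT PAIR `(r, 0)` with `|r| ≤ c₃₅·M_sz·α₀` is (3.35)-regular on II-E's carrier (sups `≤`, first quotients of `0` vanish). [cite: Balaban1985BackgroundPropagators, (3.35) p.396 (shape)] -/
theorem reg335_const_coeffBgFO (M : Fin (d + 1) → ℕ) [∀ μ, NeZero (M μ)] (n : ℕ) [NeZero n] {Msz c35 α₀ r : ℝ} (hr : |r| ≤ c35 * Msz * α₀) :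
    (coeffBgFO M n Msz).Reg335 c35 α₀ ((fun _ => r, fun _ _ => 0) : (Tor (fine n M) × Fin (d + 1) → ℝ) × (Fin (d + 1) → Tor (fine n M) × Fin (d + 1) → ℝ)) := by
  have h0 : (0 : ℝ) ≤ c35 * Msz * α₀ := (abs_nonneg r).trans hr
  refine (reg335_coeffBgFO_iff M n Msz c35 α₀ _).2 ⟨fun _ => hr, fun _ _ => by rw [abs_zero]; exact h0, fun μ κ z => ?_⟩
  rw [fgrad_apply]
  show |((n : ℕ) : ℝ) * ((0 : ℝ) - 0)| ≤ _
  rw [sub_zero, mul_zero, abs_zero]; exact h0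

/-- … and it is NOT the trivial configuration `one = 0` when `r ≠ 0`. [folklore] -/
theorem const_ne_one_coeffBgFO (M : Fin (d + 1) → ℕ) [∀ μ, NeZero (M μ)] (n : ℕ) [NeZero n] (Msz : ℝ) {r : ℝ} (hr : r ≠ 0) :
    ((fun _ => r, fun _ _ => 0) : (Tor (fine n M) × Fin (d + 1) → ℝ) × (Fin (d + 1) → Tor (fine n M) × Fin (d + 1) → ℝ)) ≠ (coeffBgFO M n Msz).one := by
  intro h
  have h1 := congrArg (fun U : (Tor (fine n M) × Fin (d + 1) → ℝ) × (Fin (d + 1) → Tor (fine n M) × Fin (d + 1) → ℝ) => U.1 ((fun _ => 0), 0)) h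
  exact hr h1

/-- ★ **THE BACKGROUND QUANTIFIER IS NOT VOID**: at every sized index, every `α₀ > 0` and every level `c₃₅ > 0` the (3.35)-class of the fine carrier contains a configuration OTHER than
`one` — the `∀ U, Reg335 c₃₅ α₀ U → …` clauses of `NE2PlusOperator`∕`NE2PlusUnit` on this family speak about more than `U ≡ 1`. [cite: Balaban1985BackgroundPropagators, (3.35) p.396 (shape)] -/
theorem exists_reg335_ne_one (hL : Odd L ∧ 1 < L) (j : TGIndexS) {c35 α₀ : ℝ} (hc35 : 0 < c35) (hα₀ : 0 < α₀) :
    ∃ U : (foInstanceFG d hL j).Bf.Cfg, (foInstanceFG d hL j).Bf.Reg335 c35 α₀ U ∧ U ≠ (foInstanceFG d hL j).Bf.one := by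
  have hM : (0 : ℝ) < j.Msz := zero_lt_one.trans_le j.one_le_Msz
  have hr : 0 < c35 * j.Msz * α₀ := by positivity
  exact ⟨_, reg335_const_coeffBgFO (TGIndex.Mn d hL j.toTGIndex) (L ^ j.m * L ^ j.k) (r := c35 * j.Msz * α₀) (by rw [abs_of_pos hr]),
    const_ne_one_coeffBgFO (TGIndex.Mn d hL j.toTGIndex) (L ^ j.m * L ^ j.k) j.Msz hr.ne'⟩

/-- **RR-1's DISPLAY HOLDS AT THE LITERAL**: `Populated` (the sized index is inhabited). [bookkeeping] -/
theorem populated_allEntriesBgObjects (hL : Odd L ∧ 1 < L) (b aS : ℝ) (ν κ α β : Fin (d + 1)) (c35 p : ℝ) :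
    (allEntriesBgObjects d hL b aS ν κ α β c35 p).Populated :=
  (NE2Objects₁₁.populated_iff _).2 tgIndexS_nonempty

/-! ## §3 The family-keyed editions (`d + 1 = 4`, block factor `F.L`) -/

/-- A four-torus family's block factor is odd and `> 1`, hence `≥ 3`. [folklore] -/
theorem three_le_blockFactor (F : T4Family) : 3 ≤ F.L := by
  obtain ⟨k, hk⟩ := F.hL.1
  have := F.hL.2
  omega

/-- ★★ `N15At` AT THE FAMILY-KEYED LITERAL (`(d, L) := (3, F.L)`; `b, a_S, c₃₅ > 0`). [bookkeeping] -/
theorem n15At_allEntriesBgObjects_family {b aS c35 : ℝ} (hb : 0 < b) (haS : 0 < aS) (hc35 : 0 < c35) (ν κ α β : Fin 4) (p : ℝ) (F : T4Family) :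
    N15At (ne2OfRecord₁₁ (haveI := neZero_blockFactor F; allEntriesBgObjects 3 F.hL b aS ν κ α β c35 p)) := by
  haveI := neZero_blockFactor F
  exact n15At_allEntriesBgObjects (d := 3) (by norm_num) F.hL.1 (three_le_blockFactor F) F.hL hb haS hc35 ν κ α β p

/-- ★★ the family-keyed literal is LIVE (`c₃₅ ≥ 0`). [bookkeeping] -/
theorem live_allEntriesBgObjects_family (b aS : ℝ) (ν κ α β : Fin 4) {c35 : ℝ} (hc35 : 0 ≤ c35) (p : ℝ) (F : T4Family) :
    Live (ne2OfRecord₁₁ (haveI := neZero_blockFactor F; allEntriesBgObjects 3 F.hL b aS ν κ α β c35 p)) := by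
  haveI := neZero_blockFactor F
  exact live_allEntriesBgObjects F.hL b aS ν κ α β hc35 p

/-- `Populated` at the family-keyed literal. [bookkeeping] -/
theorem populated_allEntriesBgObjects_family (F : T4Family) (b aS : ℝ) (ν κ α β : Fin 4) (c35 p : ℝ) :
    (haveI := neZero_blockFactor F; allEntriesBgObjects 3 F.hL b aS ν κ α β c35 p).Populated := by
  haveI := neZero_blockFactor F
  exact populated_allEntriesBgObjects F.hL b aS ν κ α β c35 p

variable {N : ℕ} [NeZero N] {key : (F : T4Family) → Datum F N → Prop}

/-- ★★ **THE FAMILY-KEYED READING AT ANY KEYED HOME** (part 30's interface; `(d, L) := (3, F.L)` at each family; `b, a_S, c₃₅ > 0`). [bookkeeping] -/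
theorem s_N15_of_admits_allEntriesBg_family {b aS c35 : ℝ} (hb : 0 < b) (haS : 0 < aS) (hc35 : 0 < c35) (ν κ α β : Fin 4) (p : ℝ)
    (ne2At : ∀ {F : T4Family} {D : Datum F N}, key F D → (ℕ → ℝ) → List (ULoop F) → ℕ → NE2Objects₁₁) (RRec : RateRecordPred N)
    (hadm : ∀ (F : T4Family) (D : Datum F N) (g₀ : ℕ → ℝ) (os : List (ULoop F)) (R : RateCarriers N), RRec F D g₀ os R →
      ∃ (h : key F D) (k : ℕ), R.ne2 = ne2OfRecord₁₁ (ne2At h g₀ os k))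
    (h : ∀ (F : T4Family) (D : Datum F N) (h : key F D) (g₀ : ℕ → ℝ) (os : List (ULoop F)) (k : ℕ),
      ne2At h g₀ os k = haveI := neZero_blockFactor F; allEntriesBgObjects 3 F.hL b aS ν κ α β c35 p) :
    S_N15 RRec := by
  refine s_N15_of_admits ne2At RRec hadm fun F D hk g₀ os k => ?_
  rw [h F D hk g₀ os k]
  exact n15At_allEntriesBgObjects_family hb haS hc35 ν κ α β p F

end Summit.QuantumFields.YangMills.BalabanUVNodes.N15.UnitLayerBg

end
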